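import Summits.MatrixMultiplication.MatrixMultiplication.Theorems.PairwiseCurvedTilingsLC.Negative.EtaleCertificateFormula
import Summits.MatrixMultiplication.MatrixMultiplication.Theorems.PairwiseCurvedTilingsLC.Negative.ChartInduction
import Literature.ModelTheory.PseudofiniteFields.EtaleOpenTopologyProofs
import Literature.ModelTheory.PseudofiniteFields.SmoothLocusDimension
import Literature.ModelTheory.PseudofiniteFields.AlgebraicBoundedness
import Literature.ModelTheory.PseudofiniteFields.CharZeroUniformBound

/-!
# Algebraic boundedness of characteristic-zero pseudo-finite fields from CDM Prop. (2.7)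
(line LonelyTranslates c1, Prop27Reduction, stage D)

`algebraicBoundedness_charZero_of_prop27 : prop27 → ∀ φ, ∃ C, …` — in every pseudo-finite field of
characteristic `0`, a definable set `φ(K^m; y)` with `C + 1` distinct points is infinite, `C`
depending on `φ` only.  This replaces, in the refutation of `PairwiseCurvedTilingsLC`, the use of
the CDM Main Theorem (hence of Lang–Weil, Prop. (3.3)).  Proof: an infinite definable set
contains a nonempty étale-open piece of a positive-dimensional standard smooth locus
(`stub_openPiece`, from Prop. (2.7)); such a piece of complexity `≤ N` is certified by ONE ring
formula `Ψ_N(y)` (`exists_certFormula`) and is infinite by Johnson–Tran–Walsberg–Ye 7.1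
(`JohnsonTranWalsbergYe2024_thm71_psf_holds`, a theorem of the tree); compactness over
characteristic-`0` pseudo-finite fields (`exists_uniform_bound_of_pseudoFinite_charZero`) applied
to `χ_N := ¬("≥ N+1 distinct points") ∨ Ψ_N` gives the uniform `C`.
-/

set_option linter.dupNamespace false

namespace Summit.MatrixMultiplication.MatrixMultiplication.Theorems.PairwiseCurvedTilingsLC.Negative

open FirstOrder FirstOrder.Language FirstOrder.Ring
open Literature.ModelTheory.PseudofiniteFields

section Boxes

variable {K : Type} [Field K] {σ : Type} [Fintype σ] [DecidableEq σ]

/-- **Box representation**: a polynomial of total degree `≤ N` is the box polynomial of its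
coefficients. [folklore] -/
theorem exists_box_repr (P : MvPolynomial σ K) {N : ℕ} (hN : P.totalDegree ≤ N) :
    ∃ d : (σ → Fin (N + 1)) → K, ∑ β : σ → Fin (N + 1), MvPolynomial.monomial
      (Finsupp.equivFunOnFinite.symm fun l => (β l : ℕ)) (d β) = P := by
  classical
  let toF : (σ → Fin (N + 1)) → (σ →₀ ℕ) := fun β => Finsupp.equivFunOnFinite.symm fun l => (β l : ℕ)
  have htoF_inj : Function.Injective toF := by
    intro β β' h
    funext l
    have := congrArg (fun f : σ →₀ ℕ => f l) h
    simp only [toF, Finsupp.coe_equivFunOnFinite_symm] at this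
    exact Fin.ext this
  refine ⟨fun β => P.coeff (toF β), ?_⟩
  have hsupp : ∀ s ∈ P.support, ∃ β : σ → Fin (N + 1), toF β = s := by
    intro s hs
    have hsle : ∀ l, s l ≤ N := by
      intro l
      have h1 : s l ≤ s.sum fun _ e => e := by
        by_cases hl : l ∈ s.support
        · exact Finset.single_le_sum (fun _ _ => Nat.zero_le _) hl
        · rw [Finsupp.notMem_support_iff.1 hl]; exact Nat.zero_le _
      have h2 : (s.sum fun _ e => e) ≤ P.totalDegree := MvPolynomial.le_totalDegree hs
      omega
    refine ⟨fun l => ⟨s l, Nat.lt_succ_of_le (hsle l)⟩, ?_⟩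
    ext l; simp [toF]
  conv_rhs => rw [P.as_sum]
  rw [← Finset.sum_image (f := fun s => MvPolynomial.monomial s (P.coeff s))
    (fun β _ β' _ h => htoF_inj h)]
  symm
  apply Finset.sum_subset
  · intro s hs
    obtain ⟨β, rfl⟩ := hsupp s hs
    exact Finset.mem_image.2 ⟨β, Finset.mem_univ _, rfl⟩
  · intro s _ hs
    rw [MvPolynomial.notMem_support_iff.1 hs, map_zero]

end Boxes

section Certificate

variable {K : Type} [Field K] [CompatibleRing K] {m n : ℕ}

/-- From explicit data to the certificate formula. [folklore] -/
theorem realize_cert_of_data (φ : Language.ring.Formula (Fin m ⊕ Fin n)) (Ψ : ℕ → Language.ring.Formula (Fin n))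
    (hΨ : ∀ N (y : Fin n → K), (Ψ N).Realize y ↔ ∃ (c : Fin m) (cols : Fin c ↪ Fin m) (r : Fin (N + 1))
        (d : ((Fin c × (Fin m → Fin (N + 1))) ⊕ (Fin m → Fin (N + 1))) ⊕
          ((Fin r × ((Fin m ⊕ Fin r) → Fin (N + 1))) ⊕ ((Fin m ⊕ Fin r) → Fin (N + 1))) → K),
        ((⟨fun i => ∑ β : (Fin m ⊕ Fin r) → Fin (N + 1), MvPolynomial.monomial
              (Finsupp.equivFunOnFinite.symm fun l => (β l : ℕ)) (d (Sum.inr (Sum.inl (i, β)))),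
            ∑ β : (Fin m ⊕ Fin r) → Fin (N + 1), MvPolynomial.monomial
              (Finsupp.equivFunOnFinite.symm fun l => (β l : ℕ)) (d (Sum.inr (Sum.inr β)))⟩ :
            EtaleDatum K m r).image ∩
          (⟨fun i => ∑ β : Fin m → Fin (N + 1), MvPolynomial.monomial
              (Finsupp.equivFunOnFinite.symm fun l => (β l : ℕ)) (d (Sum.inl (Sum.inl (i, β)))),
            ∑ β : Fin m → Fin (N + 1), MvPolynomial.monomial
              (Finsupp.equivFunOnFinite.symm fun l => (β l : ℕ)) (d (Sum.inl (Sum.inr β))),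
            cols⟩ : SmoothDatum K m c).locus).Nonempty ∧
        (⟨fun i => ∑ β : (Fin m ⊕ Fin r) → Fin (N + 1), MvPolynomial.monomial
              (Finsupp.equivFunOnFinite.symm fun l => (β l : ℕ)) (d (Sum.inr (Sum.inl (i, β)))),
            ∑ β : (Fin m ⊕ Fin r) → Fin (N + 1), MvPolynomial.monomial
              (Finsupp.equivFunOnFinite.symm fun l => (β l : ℕ)) (d (Sum.inr (Sum.inr β)))⟩ :
            EtaleDatum K m r).image ∩
          (⟨fun i => ∑ β : Fin m → Fin (N + 1), MvPolynomial.monomial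
              (Finsupp.equivFunOnFinite.symm fun l => (β l : ℕ)) (d (Sum.inl (Sum.inl (i, β)))),
            ∑ β : Fin m → Fin (N + 1), MvPolynomial.monomial
              (Finsupp.equivFunOnFinite.symm fun l => (β l : ℕ)) (d (Sum.inl (Sum.inr β))),
            cols⟩ : SmoothDatum K m c).locus ⊆ {x | φ.Realize (Sum.elim x y)})
    (y : Fin n → K) {c : ℕ} (hc : c < m) (S : SmoothDatum K m c) {r : ℕ} (E : EtaleDatum K m r)
    (hne : (E.image ∩ S.locus).Nonempty) (hsub : E.image ∩ S.locus ⊆ {x | φ.Realize (Sum.elim x y)}) :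
    ∃ N, (Ψ N).Realize y := by
  classical
  -- a common complexity bound
  obtain ⟨g, h, cols⟩ := S
  obtain ⟨G, H⟩ := E
  set N : ℕ := r + (Finset.univ.sup fun i => (g i).totalDegree) + h.totalDegree +
    (Finset.univ.sup fun i => (G i).totalDegree) + H.totalDegree with hN
  have hg : ∀ i, (g i).totalDegree ≤ N := fun i =>
    (Finset.le_sup (f := fun i => (g i).totalDegree) (Finset.mem_univ i)).trans (by omega)
  have hh : h.totalDegree ≤ N := by omega
  have hG : ∀ i, (G i).totalDegree ≤ N := fun i =>
    (Finset.le_sup (f := fun i => (G i).totalDegree) (Finset.mem_univ i)).trans (by omega)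
  have hH : H.totalDegree ≤ N := by omega
  choose dg hdg using fun i => exists_box_repr (g i) (hg i)
  obtain ⟨dh, hdh⟩ := exists_box_repr h hh
  choose dG hdG using fun i => exists_box_repr (G i) (hG i)
  obtain ⟨dH, hdH⟩ := exists_box_repr H hH
  refine ⟨N, (hΨ N y).2 ⟨⟨c, hc⟩, cols, ⟨r, by omega⟩,
    Sum.elim (Sum.elim (fun p => dg p.1 p.2) dh) (Sum.elim (fun p => dG p.1 p.2) dH), ?_⟩⟩
  simp only [Sum.elim_inl, Sum.elim_inr, hdg, hdh, hdG, hdH]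
  exact ⟨hne, hsub⟩


/-- From the certificate formula to explicit data. [folklore] -/
theorem data_of_realize_cert (φ : Language.ring.Formula (Fin m ⊕ Fin n)) (Ψ : ℕ → Language.ring.Formula (Fin n))
    (hΨ : ∀ N (y : Fin n → K), (Ψ N).Realize y ↔ ∃ (c : Fin m) (cols : Fin c ↪ Fin m) (r : Fin (N + 1))
        (d : ((Fin c × (Fin m → Fin (N + 1))) ⊕ (Fin m → Fin (N + 1))) ⊕
          ((Fin r × ((Fin m ⊕ Fin r) → Fin (N + 1))) ⊕ ((Fin m ⊕ Fin r) → Fin (N + 1))) → K),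
        ((⟨fun i => ∑ β : (Fin m ⊕ Fin r) → Fin (N + 1), MvPolynomial.monomial
              (Finsupp.equivFunOnFinite.symm fun l => (β l : ℕ)) (d (Sum.inr (Sum.inl (i, β)))),
            ∑ β : (Fin m ⊕ Fin r) → Fin (N + 1), MvPolynomial.monomial
              (Finsupp.equivFunOnFinite.symm fun l => (β l : ℕ)) (d (Sum.inr (Sum.inr β)))⟩ :
            EtaleDatum K m r).image ∩
          (⟨fun i => ∑ β : Fin m → Fin (N + 1), MvPolynomial.monomial
              (Finsupp.equivFunOnFinite.symm fun l => (β l : ℕ)) (d (Sum.inl (Sum.inl (i, β)))),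
            ∑ β : Fin m → Fin (N + 1), MvPolynomial.monomial
              (Finsupp.equivFunOnFinite.symm fun l => (β l : ℕ)) (d (Sum.inl (Sum.inr β))),
            cols⟩ : SmoothDatum K m c).locus).Nonempty ∧
        (⟨fun i => ∑ β : (Fin m ⊕ Fin r) → Fin (N + 1), MvPolynomial.monomial
              (Finsupp.equivFunOnFinite.symm fun l => (β l : ℕ)) (d (Sum.inr (Sum.inl (i, β)))),
            ∑ β : (Fin m ⊕ Fin r) → Fin (N + 1), MvPolynomial.monomial
              (Finsupp.equivFunOnFinite.symm fun l => (β l : ℕ)) (d (Sum.inr (Sum.inr β)))⟩ :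
            EtaleDatum K m r).image ∩
          (⟨fun i => ∑ β : Fin m → Fin (N + 1), MvPolynomial.monomial
              (Finsupp.equivFunOnFinite.symm fun l => (β l : ℕ)) (d (Sum.inl (Sum.inl (i, β)))),
            ∑ β : Fin m → Fin (N + 1), MvPolynomial.monomial
              (Finsupp.equivFunOnFinite.symm fun l => (β l : ℕ)) (d (Sum.inl (Sum.inr β))),
            cols⟩ : SmoothDatum K m c).locus ⊆ {x | φ.Realize (Sum.elim x y)})
    {N : ℕ} {y : Fin n → K} (h : (Ψ N).Realize y) :
    ∃ (c : ℕ) (S : SmoothDatum K m c) (r : ℕ) (E : EtaleDatum K m r), c < m ∧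
      (E.image ∩ S.locus).Nonempty ∧ E.image ∩ S.locus ⊆ {x | φ.Realize (Sum.elim x y)} := by
  obtain ⟨c, cols, r, d, hne, hsub⟩ := (hΨ N y).1 h
  exact ⟨c, _, r, _, c.2, hne, hsub⟩

/-- A nonempty étale-open piece of a positive-dimensional standard smooth locus inside a set
makes it infinite (pseudo-finite `K`, Johnson–Tran–Walsberg–Ye 7.1). [folklore] -/
theorem infinite_of_data [Infinite K] (hK : K ⊨ finiteFieldTheory) {A : Set (Fin m → K)}
    {c : ℕ} (hc : c < m) (S : SmoothDatum K m c) {r : ℕ} (E : EtaleDatum K m r)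
    (hne : (E.image ∩ S.locus).Nonempty) (hsub : E.image ∩ S.locus ⊆ A) : A.Infinite := by
  refine Set.Infinite.mono hsub (infinite_of_isEtaleOpenIn
    (fun p => JohnsonTranWalsbergYe2024_thm71_psf_holds K hK m c hc S p) ?_ hne)
  exact ⟨Set.inter_subset_right, fun p hp => ⟨r, E, hp.1, subset_rfl⟩⟩

end Certificate

/-- **Algebraic boundedness of characteristic-zero pseudo-finite fields, from CDM Prop. (2.7).** -/
theorem algebraicBoundedness_charZero_of_prop27 (h27 : ChatzidakisVanDenDriesMacintyre1992_prop27)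
    (m n : ℕ) (φ : Language.ring.Formula (Fin m ⊕ Fin n)) :
    ∃ C : ℕ, ∀ (K : Type) [Field K] [CompatibleRing K] [CharZero K], K ⊨ finiteFieldTheory →
      ∀ (y : Fin n → K) (w : Fin (C + 1) → (Fin m → K)), Function.Injective w →
        (∀ j, φ.Realize (Sum.elim (w j) y)) →
          {x : Fin m → K | φ.Realize (Sum.elim x y)}.Infinite := by
  classical
  choose Ψ hΨ using fun N => exists_certFormula m n N φ
  choose θD hθD using fun M => exists_formula_injective_realize.{0} m n M φ
  -- in every characteristic-zero pseudo-finite field every `y` satisfies some `χ_N`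
  obtain ⟨N₀, hN₀⟩ := FiniteField.exists_uniform_bound_of_pseudoFinite_charZero
    (fun N => (θD (N + 1)).not ⊔ Ψ N) fun K _ _ _ hK y => by
      haveI : Infinite K := Infinite.of_injective (Nat.cast : ℕ → K) Nat.cast_injective
      by_cases hinf : {x : Fin m → K | φ.Realize (Sum.elim x y)}.Infinite
      · obtain ⟨c, S, X, hc, hXA, ⟨p, hp⟩, hXloc, hXnb⟩ := stub_openPiece h27 K hK φ y hinf
        obtain ⟨r, E, hpE, hE⟩ := hXnb p hp
        obtain ⟨N, hN⟩ := realize_cert_of_data φ Ψ (fun N y => hΨ N K y) y hc S E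
          ⟨p, hpE, hXloc hp⟩ (hE.trans hXA)
        exact ⟨N, Formula.realize_sup.2 (Or.inr hN)⟩
      · have hfin : {x : Fin m → K | φ.Realize (Sum.elim x y)}.Finite := Set.not_infinite.1 hinf
        refine ⟨hfin.toFinset.card, Formula.realize_sup.2 (Or.inl ?_)⟩
        rw [Formula.realize_not, hθD]
        rintro ⟨w, hw, hφw⟩
        have hmem : ∀ j, w j ∈ hfin.toFinset := fun j => hfin.mem_toFinset.2 (hφw j)
        have := Finset.card_le_card_of_injOn (s := (Finset.univ : Finset (Fin (hfin.toFinset.card + 1))))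
          w (fun j _ => hmem j) (hw.injOn)
        simp at this
  refine ⟨N₀, fun K _ _ _ hK y w hw hφw => ?_⟩
  haveI : Infinite K := Infinite.of_injective (Nat.cast : ℕ → K) Nat.cast_injective
  obtain ⟨n', hn', hreal⟩ := hN₀ K hK y
  rcases Formula.realize_sup.1 hreal with h | h
  · -- `¬(n'+1 distinct points)` contradicts the `N₀ + 1 ≥ n' + 1` given ones
    rw [Formula.realize_not, hθD] at h
    have hle : n' + 1 ≤ N₀ + 1 := by omega
    exact absurd ⟨fun j => w (Fin.castLE hle j),
      hw.comp (Fin.castLE_injective hle), fun j => hφw _⟩ h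
  · obtain ⟨c, S, r, E, hc, hne, hsub⟩ := data_of_realize_cert φ Ψ (fun N y => hΨ N K y) h
    exact infinite_of_data hK hc S E hne hsub


end Summit.MatrixMultiplication.MatrixMultiplication.Theorems.PairwiseCurvedTilingsLC.Negative
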